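import Summits.QuantumFields.BalabanUV.Gaps.CapSignsConstRoad
import Literature.MathematicalPhysics.QuantumFieldTheory.Balaban1983to89.T4CouplingMatching
import Literature.MathematicalPhysics.QuantumFieldTheory.Balaban1983to89.T4FlagMemory

/-!
# NODE N17 (NE4) — WHAT IT DELIVERS TO CRUX K2⁷'s LINE 2 «shift-cauchy-everyslope», PART 1 (generic): THE JUNCTION «full-β scale shift + per-scale anchor ⟹
# remainder shift, constant `2c`, NO rate hypothesis» AND THE LEVER «⟹ every-slope» UNDER A SUMMABLE SCALE-SHIFT MODULUS; a located negative

Cell `pub-ymgap`, YM-PLAN Track A (HUMAN RULING D-0062 ∕ D-0149), WIDTH SEAT `pub-ymgap-dag-n17-w2` (gen 2), key K3⁷ stmt-QuantumFields-20544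
(`--kind proof --supports 20544 --as helper`, COUNT-NEUTRAL); via node N17 also K2⁷ stmt-QuantumFields-20543, LINE 2 of the registered skeleton v3
(`HOME/pub-ymgap-plan/D80-K2V3/K2Skeleton13SepCoPHv3.lean` bdd723a03d543770, §L2.1–§L2.3: stubs `stub_n17AtRecord13`, `stub_anchor13`; kernel junction `d4ShiftRate13_of_n17_anchor`,
lever `everySlope_of_shiftRate_anchor` — texts of seat ym-nodeO-idea-7's sketch `Cruxes/EndpointGivenBR13SepCoPH/ShiftCauchyEverySlopeSketch.lean` ed.2 and of refuter CRIT-2's probe,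
`Cruxes/EndpointGivenBR13SepCoPH/TRIAGE-crit2-shift-cauchy-everyslope.md`).  The skeleton and the sketch are not tree modules; this file RE-PROVES (does not re-host) their junction
and lever in a SHARPER and MORE GENERAL form.  PART 2 (`…N17ShiftModulusAnchorRecord13.lean`) instantiates at NODE 00's Stage-13 record and spells the K2⁷ texts.

THE OBJECTS.  `β : FlowStep.HBeta` (history-dependent β-functions, [Balaban1987RG1] p. 298), `S : B12Beta.OneLoopSplit β` (the printed one-loop split, (2.12)–(2.14) p. 268).
NE4 = node N17 = `T4CouplingMatching.ScaleShiftRate c ρ γ β`: `|β_{k+2}(w) − β_{k+1}(Fin.tail w)| ≤ c·ρ^k` on `]0,γ]^{k+2}` (NOT PRINTED: [I] p. 264 «We will investigate other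
properties in a separate paper»; GAPS G-t4-U2-1); its remainder half `T4CouplingMatching.RemainderShiftRate S c₁ ρ γ`.  The PER-SCALE ANCHOR (K2⁷ v3 `AnchorVanishing S`, spelled
INLINE since the skeleton is not importable): `∀ k, ∀ δ > 0, ∃ γ' > 0, ∀ v ∈ ]0,γ']^{k+1}, |β¹_{k+1}(v)| ≤ δ` ((2.13) p. 268 «vanishes at g_k = 0», read per scale).  The every-slope
currency of row (D4): `Gaps.CapSignsConstRoad.EverySlope S γ` («∀ s > 0, |β¹| ≤ s on SOME box `]0,γ_s] ⊆ ]0,γ]`, uniformly in k»).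

WHAT THIS FILE PROVES (theorems only; 0 `def`, 0 `instance`, 0 `sorry`).
§1 GENERIC, over a SCALE-SHIFT MODULUS `a : ℕ → ℝ` of the FULL β (hypothesis inline `∀ k w ∈ ]0,γ]^{k+2}, |β_{k+2}(w) − β_{k+1}(tail w)| ≤ a_k`; NE4 is `a_k = cρ^k`):
`shiftModulus_nonneg`; `abs_beta0_step_le_of_shiftModulus_anchor` (modulus + anchor ⟹ ONE-LOOP STEP `|β⁰_{k+2} − β⁰_{k+1}| ≤ a_k`, at the constant history `(t,…,t)`, `t → 0⁺`);
★ `remainder_shift_le_two_mul_of_shiftModulus_anchor` — THE JUNCTION: the remainder's shift modulus is `2·a_k`, NO hypothesis on the modulus (the skeleton's ∕ CRIT-2's junction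
routes through `β⁰_∞` and gets `c + 2c∕(1−ρ)` under `0 ≤ ρ < 1`; the tree's `T4BetaMemorySharp.remainderShiftRate_of_scaleShiftRate` takes (AF-0r) as input); `anchor_upTo`;
`remainder_shift_iterate` (telescoping); `exists_lim_beta0_of_summable_shiftModulus_anchor` (`Σ a_k < ∞` + anchor ⟹ the one-loop numbers CONVERGE, `|β⁰_{k+1} − β⁰_∞| ≤ Σ_m a_{k+m}`);
★★ `everySlope_of_summable_shiftModulus_anchor` — THE LEVER under a SUMMABLE modulus: K2⁷ line 2 consumes from node N17 ONLY «the full β has a summable two-run scale-shift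
modulus on the boxes», strictly less than NE4's geometric rate (CRIT-2's CORRELATED-FAILURE RISK P1 located more finely: line 2 survives a failure of the GEOMETRIC rate as long
as a summable one holds).
§2 GEOMETRIC INSTANCES BY NAME: ★ `remainderShiftRate_two_mul_of_scaleShiftRate_anchor : 0 < γ → anchor → ScaleShiftRate c ρ γ β → RemainderShiftRate S (2*c) ρ γ` (no
hypothesis on `ρ`); `conv_of_scaleShiftRate_anchor` (`ρ < 1`); `everySlope_of_scaleShiftRate_anchor` (`0 ≤ ρ < 1`).
§3 LOCATED NEGATIVE (kernel witness `β¹_{k+1}(p) = min 1 ((k+1)p_k)`, `β⁰ ≡ 0`): `anchor_not_sufficient_for_everySlope` — the per-scale anchor ALONE gives every-slope on NO box;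
the shift control of node N17 (or at least a summable modulus) is load-bearing on line 2.
§4 (EDITION 2, append-only) LOCATED WITNESS `summable_shiftModulus_anchor_not_geometric` (kernel: `β_{k+1}(p) = (Σ_{j<k} 1∕(j+1)²)·min 1 p_k`, `β⁰ ≡ 0`): the anchor
holds, the full β has the SUMMABLE modulus `1∕(k+1)²` on every window (so every-slope HOLDS by the §1 lever), yet `ScaleShiftRate c ρ γ β` FAILS for every `c`, every
`0 ≤ ρ < 1`, every `γ > 0` — the summable lever is STRICTLY more general than the NE4-keyed one (K2⁷ line 2's END conclusion survives where `N17AtRecord13` as typed fails).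

HONEST SCOPE (A6, director-ym №189).  Elementary real analysis over hypothesis SHAPES; nothing of Bałaban asserted; NE4 ∕ the anchor ∕ (AF-0r) NOT PRINTED and NOT proved; NOT a
proof of any K2⁷∕K3⁷ stub; N17 NOT discharged; K2⁷ ∕ K3⁷ OPEN; counts UNMOVED (typed 28∕28 · discharged 5∕27 · A 5∕28).  One finite four-torus programme at fixed `ε = L^{−K}`,
Bałaban AS PRINTED; the YM mass gap (Clay) is NOT proved by any of this — R4 closes the conditional finite-𝕋⁴ rung `BalabanLadder.UV` only; nothing continuum ∕ ℝ⁴ ∕ OS.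
No `instance`, no `notation`, no `axiom`.  References: [I] = [Balaban1987RG1] T. Bałaban, Commun. Math. Phys. **109** (1987): (1.20)–(1.22) p. 264, (2.12)–(2.14) p. 268,
Thm 3 p. 264, p. 298; King's printed template of the scale-shift shape [King1986] Thm 3.4 (3.9) p. 656 (cited by `T4CouplingMatching.ScaleShiftRate`).
-/

noncomputable section

namespace Summit.QuantumFields.YangMills.BalabanUVNodes.N17ShiftModulusAnchor

open Literature.MathematicalPhysics.QuantumFieldTheory.Balaban1983to89
open Literature.MathematicalPhysics.QuantumFieldTheory.Balaban1983to89.FlowStep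
open Literature.MathematicalPhysics.QuantumFieldTheory.Balaban1983to89.T4CouplingMatching (ScaleShiftRate RemainderShiftRate)
open Literature.MathematicalPhysics.QuantumFieldTheory.Balaban1983to89.T4FlagMemory (tail_mem_box)
open Literature.MathematicalPhysics.QuantumFieldTheory.Balaban1983to89.Beta.RemainderChain (RemainderConst)
open Summit.QuantumFields.BalabanUV.Gaps.CapSignsConstRoad (EverySlope)
open Finset Filter Topology

/-! ## §1 Generic: a SUMMABLE scale-shift modulus of the full β + the per-scale anchor -/

section Generic

variable {β : HBeta} (S : B12Beta.OneLoopSplit β) {a r : ℕ → ℝ} {γ : ℝ}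

/-- On a non-empty window (`0 < γ`) a scale-shift modulus of the full β is non-negative: evaluate at the constant history `(γ,…,γ)`.
(The geometric instance is `Spine.NE4.AsymptoticContent.scaleShiftRate_const_nonneg`.) [folklore] -/
theorem shiftModulus_nonneg (hγ : 0 < γ)
    (h : ∀ k (w : Fin (k + 2) → ℝ), w ∈ Box γ (k + 1) → |β (k + 1) w - β k (Fin.tail w)| ≤ a k) (k : ℕ) : 0 ≤ a k := by
  have hw : (fun _ : Fin (k + 2) => γ) ∈ Box γ (k + 1) := mem_box.mpr fun _ => ⟨hγ, le_rfl⟩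
  exact (abs_nonneg _).trans (h k _ hw)

/-- **THE ONE-LOOP STEP under a modulus and the per-scale anchor**: `|β⁰_{k+2} − β⁰_{k+1}| ≤ a_k`.  Evaluate the full-β shift at the constant history `(t,…,t)`
with `t` below `γ` and below the anchor radii of scales `k`, `k+1` at tolerance `ε∕2`, subtract the two remainders, let `ε → 0`.  (Anchor variant of the tree's
`Spine.NE4.AsymptoticContent.abs_beta0_step_le_of_scaleShiftRate`, which uses the k-UNIFORM corner bound `|β¹_{k+1}(p)| ≤ C·p_k` instead; re-proof of the K2⁷ v3 skeleton's
`abs_beta0_step_le_of_scaleShiftRate_anchor` for a general modulus.) [cite: Balaban1987RG1, (2.12)-(2.14) p.268] -/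
theorem abs_beta0_step_le_of_shiftModulus_anchor (hγ : 0 < γ)
    (hA : ∀ (k : ℕ) (δ : ℝ), 0 < δ → ∃ γ' : ℝ, 0 < γ' ∧ ∀ v ∈ Box γ' k, |S.β1 k v| ≤ δ)
    (h : ∀ k (w : Fin (k + 2) → ℝ), w ∈ Box γ (k + 1) → |β (k + 1) w - β k (Fin.tail w)| ≤ a k) (k : ℕ) :
    |S.β0 (k + 1) - S.β0 k| ≤ a k := by
  refine le_of_forall_pos_le_add fun ε hε => ?_
  obtain ⟨γ₁, hγ₁, hA₁⟩ := hA (k + 1) (ε / 2) (half_pos hε)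
  obtain ⟨γ₀, hγ₀, hA₀⟩ := hA k (ε / 2) (half_pos hε)
  set t : ℝ := min γ (min γ₁ γ₀) with ht
  have ht0 : 0 < t := lt_min hγ (lt_min hγ₁ hγ₀)
  have htγ : t ≤ γ := min_le_left _ _
  have htγ₁ : t ≤ γ₁ := (min_le_right _ _).trans (min_le_left _ _)
  have htγ₀ : t ≤ γ₀ := (min_le_right _ _).trans (min_le_right _ _)
  let w : Fin (k + 2) → ℝ := fun _ => t
  have hw : w ∈ Box γ (k + 1) := mem_box.mpr fun _ => ⟨ht0, htγ⟩
  have hw₁ : w ∈ Box γ₁ (k + 1) := mem_box.mpr fun _ => ⟨ht0, htγ₁⟩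
  have hw₀ : Fin.tail w ∈ Box γ₀ k := mem_box.mpr fun _ => ⟨ht0, htγ₀⟩
  have h1 : |β (k + 1) w - β k (Fin.tail w)| ≤ a k := h k w hw
  have h2 : |S.β1 (k + 1) w| ≤ ε / 2 := hA₁ w hw₁
  have h3 : |S.β1 k (Fin.tail w)| ≤ ε / 2 := hA₀ (Fin.tail w) hw₀
  have e : S.β0 (k + 1) - S.β0 k
      = (β (k + 1) w - β k (Fin.tail w)) - (S.β1 (k + 1) w - S.β1 k (Fin.tail w)) := by
    rw [S.split (k + 1) w, S.split k (Fin.tail w)]; ring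
  rw [e]
  calc |(β (k + 1) w - β k (Fin.tail w)) - (S.β1 (k + 1) w - S.β1 k (Fin.tail w))|
      ≤ |β (k + 1) w - β k (Fin.tail w)| + |S.β1 (k + 1) w - S.β1 k (Fin.tail w)| := abs_sub _ _
    _ ≤ a k + (|S.β1 (k + 1) w| + |S.β1 k (Fin.tail w)|) := add_le_add h1 (abs_sub _ _)
    _ ≤ a k + (ε / 2 + ε / 2) := add_le_add le_rfl (add_le_add h2 h3)
    _ = a k + ε := by ring

/-- ★ **THE JUNCTION, constant `2`, NO hypothesis on the modulus**: a scale-shift modulus `a` of the FULL β + the per-scale anchor ⟹ the REMAINDER `β¹` has the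
scale-shift modulus `2·a` on the same boxes — subtract the one-loop step `|β⁰_{k+2} − β⁰_{k+1}| ≤ a_k` from the full shift.  (The K2⁷ v3 skeleton's
`remainderShiftRate_of_scaleShiftRate_anchor` and the tree's `T4BetaMemorySharp.remainderShiftRate_of_scaleShiftRate` go through the limit `β⁰_∞`, whence their constant
`c + 2c∕(1−ρ)` and their hypothesis `0 ≤ ρ < 1`; neither is needed for this step.) [cite: Balaban1987RG1, (2.12)-(2.14) p.268] -/
theorem remainder_shift_le_two_mul_of_shiftModulus_anchor (hγ : 0 < γ)
    (hA : ∀ (k : ℕ) (δ : ℝ), 0 < δ → ∃ γ' : ℝ, 0 < γ' ∧ ∀ v ∈ Box γ' k, |S.β1 k v| ≤ δ)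
    (h : ∀ k (w : Fin (k + 2) → ℝ), w ∈ Box γ (k + 1) → |β (k + 1) w - β k (Fin.tail w)| ≤ a k)
    (k : ℕ) (w : Fin (k + 2) → ℝ) (hw : w ∈ Box γ (k + 1)) :
    |S.β1 (k + 1) w - S.β1 k (Fin.tail w)| ≤ 2 * a k := by
  have h0 : |S.β0 (k + 1) - S.β0 k| ≤ a k := abs_beta0_step_le_of_shiftModulus_anchor S hγ hA h k
  have h1 : |β (k + 1) w - β k (Fin.tail w)| ≤ a k := h k w hw
  have e : S.β1 (k + 1) w - S.β1 k (Fin.tail w)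
      = (β (k + 1) w - β k (Fin.tail w)) - (S.β0 (k + 1) - S.β0 k) := by
    rw [S.split (k + 1) w, S.split k (Fin.tail w)]; ring
  rw [e]
  calc |(β (k + 1) w - β k (Fin.tail w)) - (S.β0 (k + 1) - S.β0 k)|
      ≤ |β (k + 1) w - β k (Fin.tail w)| + |S.β0 (k + 1) - S.β0 k| := abs_sub _ _
    _ ≤ a k + a k := add_le_add h1 h0
    _ = 2 * a k := by ring

/-- Finitely many scales of the anchor at once (the minimum of finitely many positive radii).  (Re-proof of the K2⁷ v3 skeleton's `anchor_upTo`, idea-7's text.) [folklore] -/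
theorem anchor_upTo (hA : ∀ (k : ℕ) (δ : ℝ), 0 < δ → ∃ γ' : ℝ, 0 < γ' ∧ ∀ v ∈ Box γ' k, |S.β1 k v| ≤ δ) (k₀ : ℕ) {δ : ℝ} (hδ : 0 < δ) :
    ∃ γ' : ℝ, 0 < γ' ∧ ∀ k, k ≤ k₀ → ∀ v ∈ Box γ' k, |S.β1 k v| ≤ δ := by
  induction k₀ with
  | zero =>
    obtain ⟨γ', hγ', h'⟩ := hA 0 δ hδ
    refine ⟨γ', hγ', fun k hk v hv => ?_⟩
    obtain rfl := Nat.le_zero.mp hk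
    exact h' v hv
  | succ n ih =>
    obtain ⟨γ₁, hγ₁, h₁⟩ := ih
    obtain ⟨γ₂, hγ₂, h₂⟩ := hA (n + 1) δ hδ
    refine ⟨min γ₁ γ₂, lt_min hγ₁ hγ₂, fun k hk v hv => ?_⟩
    rcases Nat.lt_or_ge k (n + 1) with hlt | hge
    · exact h₁ k (Nat.lt_succ_iff.mp hlt) v (box_mono (min_le_left _ _) k hv)
    · obtain rfl := le_antisymm hk hge
      exact h₂ v (box_mono (min_le_right _ _) _ hv)

/-- TELESCOPING A REMAINDER-SHIFT MODULUS ALONG THE LADDER: from `|β¹_{k₀+1}| ≤ b` on `]0,γ']^{k₀+1}` (`γ' ≤ γ`) and a remainder-shift modulus `r` on the `]0,γ]`-boxes,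
`|β¹_{k₀+m+1}(v)| ≤ b + Σ_{j<m} r_{k₀+j}` on `]0,γ']^{k₀+m+1}` (peel the ultraviolet-most coupling with `Fin.tail`).  (General-modulus form of the K2⁷ v3 skeleton's
`shift_iterate`, idea-7's text.) [folklore] -/
theorem remainder_shift_iterate {γ' : ℝ}
    (hr : ∀ k (w : Fin (k + 2) → ℝ), w ∈ Box γ (k + 1) → |S.β1 (k + 1) w - S.β1 k (Fin.tail w)| ≤ r k)
    (hγ' : γ' ≤ γ) (k₀ : ℕ) {b : ℝ} (hbase : ∀ v ∈ Box γ' k₀, |S.β1 k₀ v| ≤ b) :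
    ∀ m : ℕ, ∀ v ∈ Box γ' (k₀ + m), |S.β1 (k₀ + m) v| ≤ b + ∑ j ∈ range m, r (k₀ + j) := by
  intro m
  induction m with
  | zero => intro v hv; simpa using hbase v hv
  | succ m ih =>
    intro v hv
    have hv₁ : v ∈ Box γ (k₀ + m + 1) := box_mono hγ' _ hv
    have hs : |S.β1 (k₀ + m + 1) v - S.β1 (k₀ + m) (Fin.tail v)| ≤ r (k₀ + m) := hr (k₀ + m) v hv₁
    have ht : |S.β1 (k₀ + m) (Fin.tail v)| ≤ b + ∑ j ∈ range m, r (k₀ + j) := ih (Fin.tail v) (tail_mem_box hv)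
    have htri : |S.β1 (k₀ + m + 1) v| - |S.β1 (k₀ + m) (Fin.tail v)| ≤ |S.β1 (k₀ + m + 1) v - S.β1 (k₀ + m) (Fin.tail v)| :=
      abs_sub_abs_le_abs_sub _ _
    rw [Finset.sum_range_succ]
    show |S.β1 (k₀ + m + 1) v| ≤ b + (∑ j ∈ range m, r (k₀ + j) + r (k₀ + m))
    linarith

/-- **(AF-0r)'s CONCLUSION WITHOUT A RATE**: a SUMMABLE scale-shift modulus of the full β + the per-scale anchor ⟹ the one-loop numbers converge, with the tail bound
`|β⁰_{k+1} − β⁰_∞| ≤ Σ_m a_{k+m}` (Mathlib's `cauchySeq_of_dist_le_of_summable` ∕ `dist_le_tsum_of_dist_le_of_tendsto` on the one-loop steps of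
`abs_beta0_step_le_of_shiftModulus_anchor`). [folklore] -/
theorem exists_lim_beta0_of_summable_shiftModulus_anchor (hγ : 0 < γ)
    (hA : ∀ (k : ℕ) (δ : ℝ), 0 < δ → ∃ γ' : ℝ, 0 < γ' ∧ ∀ v ∈ Box γ' k, |S.β1 k v| ≤ δ)
    (h : ∀ k (w : Fin (k + 2) → ℝ), w ∈ Box γ (k + 1) → |β (k + 1) w - β k (Fin.tail w)| ≤ a k) (ha : Summable a) :
    ∃ binf : ℝ, Tendsto S.β0 atTop (𝓝 binf) ∧ ∀ k, |S.β0 k - binf| ≤ ∑' m, a (k + m) := by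
  have hstep : ∀ n, dist (S.β0 n) (S.β0 n.succ) ≤ a n := fun n => by
    rw [Real.dist_eq, abs_sub_comm]
    exact abs_beta0_step_le_of_shiftModulus_anchor S hγ hA h n
  obtain ⟨binf, hlim⟩ := cauchySeq_tendsto_of_complete (cauchySeq_of_dist_le_of_summable a hstep ha)
  refine ⟨binf, hlim, fun k => ?_⟩
  have hk := dist_le_tsum_of_dist_le_of_tendsto a hstep ha hlim k
  rwa [Real.dist_eq] at hk

/-- ★★ **THE LEVER UNDER A SUMMABLE MODULUS: `Σ a_k < ∞` + the per-scale anchor ⟹ `EverySlope S γ`.**  Given `s > 0`: the remainder's modulus is `2a` (the junction);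
pick `k₀` with the tail `Σ_{j} 2a_{j+k₀} < s∕2` (`tendsto_sum_nat_add`), one anchor radius for the scales `k ≤ k₀` at tolerance `s∕2` (`anchor_upTo`), and telescope for
`k > k₀` (`remainder_shift_iterate`).  So the every-slope road of K2⁷ line 2 needs from node N17 ONLY a summable two-run modulus of the full β, not NE4's geometric rate.
(General-modulus form of the K2⁷ v3 skeleton's `everySlope_of_shiftRate_anchor`, idea-7's text.) [cite: Balaban1987RG1, (2.12)-(2.14) p.268 and Thm 3 p.264] -/
theorem everySlope_of_summable_shiftModulus_anchor (hγ : 0 < γ)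
    (hA : ∀ (k : ℕ) (δ : ℝ), 0 < δ → ∃ γ' : ℝ, 0 < γ' ∧ ∀ v ∈ Box γ' k, |S.β1 k v| ≤ δ)
    (h : ∀ k (w : Fin (k + 2) → ℝ), w ∈ Box γ (k + 1) → |β (k + 1) w - β k (Fin.tail w)| ≤ a k) (ha : Summable a) :
    EverySlope S γ := by
  intro s hs
  -- the remainder's modulus `r := 2a`, non-negative and summable
  have ha0 : ∀ k, 0 ≤ a k := shiftModulus_nonneg hγ h
  have hr : ∀ k (w : Fin (k + 2) → ℝ), w ∈ Box γ (k + 1) → |S.β1 (k + 1) w - S.β1 k (Fin.tail w)| ≤ 2 * a k :=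
    remainder_shift_le_two_mul_of_shiftModulus_anchor S hγ hA h
  have h2a : Summable fun k => 2 * a k := ha.mul_left 2
  -- a scale `k₀` beyond which the summable tail is below `s / 2`
  have htail : Tendsto (fun i => ∑' j, 2 * a (j + i)) atTop (𝓝 0) := tendsto_sum_nat_add fun k => 2 * a k
  obtain ⟨k₀, hk₀⟩ := (htail.eventually (gt_mem_nhds (half_pos hs))).exists
  -- one anchor radius for the finitely many scales `k ≤ k₀`
  obtain ⟨γa, hγa, hanchor⟩ := anchor_upTo S hA k₀ (half_pos hs)
  refine ⟨min γ γa, lt_min hγ hγa, min_le_left _ _, ?_⟩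
  intro k p hp
  rw [histBox_eq_box] at hp
  rcases Nat.lt_or_ge k₀ k with hk | hk
  · obtain ⟨m, rfl⟩ := Nat.exists_eq_add_of_le hk.le
    have hiter := remainder_shift_iterate S hr (min_le_left γ γa) k₀ (b := s / 2)
      (fun v hv => hanchor k₀ le_rfl v (box_mono (min_le_right _ _) _ hv)) m p hp
    -- the partial sum of the tail is below the full tail, hence below `s / 2`
    have hsum2 : Summable fun j => 2 * a (j + k₀) := (summable_nat_add_iff k₀).2 h2a
    have hpart : ∑ j ∈ range m, 2 * a (k₀ + j) ≤ ∑' j, 2 * a (j + k₀) := by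
      have e : ∑ j ∈ range m, 2 * a (k₀ + j) = ∑ j ∈ range m, 2 * a (j + k₀) :=
        Finset.sum_congr rfl fun j _ => by rw [Nat.add_comm]
      rw [e]
      exact hsum2.sum_le_tsum (range m) fun j _ => mul_nonneg zero_le_two (ha0 _)
    linarith [hk₀.le]
  · exact (hanchor k hk p (box_mono (min_le_right _ _) k hp)).trans (half_le_self hs.le)

end Generic

/-! ## §2 The geometric instances BY NAME: NE4 `ScaleShiftRate c ρ γ β` (node N17's shape) -/

section Geometric

variable {β : HBeta} (S : B12Beta.OneLoopSplit β) {c ρ γ : ℝ}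

/-- ★ **NE4 + per-scale anchor ⟹ the remainder's scale-shift rate with constant `2c` — NO hypothesis on the rate letter `ρ`** (the K2⁷ v3 skeleton's junction has
`c + 2c∕(1−ρ)` under `0 ≤ ρ < 1`). [cite: Balaban1987RG1, (2.12)-(2.14) p.268] -/
theorem remainderShiftRate_two_mul_of_scaleShiftRate_anchor (hγ : 0 < γ)
    (hA : ∀ (k : ℕ) (δ : ℝ), 0 < δ → ∃ γ' : ℝ, 0 < γ' ∧ ∀ v ∈ Box γ' k, |S.β1 k v| ≤ δ)
    (h : ScaleShiftRate c ρ γ β) : RemainderShiftRate S (2 * c) ρ γ := by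
  intro k w hw
  rw [mul_assoc]
  exact remainder_shift_le_two_mul_of_shiftModulus_anchor S hγ hA h k w hw

/-- The one-loop step under NE4 + anchor: `|β⁰_{k+2} − β⁰_{k+1}| ≤ c·ρ^k` (instance of `abs_beta0_step_le_of_shiftModulus_anchor`; = the K2⁷ v3 skeleton's
`abs_beta0_step_le_of_scaleShiftRate_anchor`, here a tree theorem). [cite: Balaban1987RG1, (2.12)-(2.14) p.268] -/
theorem abs_beta0_step_le_of_scaleShiftRate_anchor (hγ : 0 < γ)
    (hA : ∀ (k : ℕ) (δ : ℝ), 0 < δ → ∃ γ' : ℝ, 0 < γ' ∧ ∀ v ∈ Box γ' k, |S.β1 k v| ≤ δ)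
    (h : ScaleShiftRate c ρ γ β) (k : ℕ) : |S.β0 (k + 1) - S.β0 k| ≤ c * ρ ^ k :=
  abs_beta0_step_le_of_shiftModulus_anchor S hγ hA h k

/-- NE4 + anchor ⟹ (AF-0r) with the geometric rate: a limit `β⁰_∞` with `|β⁰_{k+1} − β⁰_∞| ≤ (c∕(1−ρ))·ρ^k` (`ρ < 1`; geometric Cauchy).  (= the K2⁷ v3 skeleton's
`conv_of_scaleShiftRate_anchor`, here a tree theorem; the tree's `Spine.NE4.AsymptoticContent.conv_of_scaleShiftRate` is the k-uniform-corner-bound variant.) [folklore] -/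
theorem conv_of_scaleShiftRate_anchor (hγ : 0 < γ) (hρ1 : ρ < 1)
    (hA : ∀ (k : ℕ) (δ : ℝ), 0 < δ → ∃ γ' : ℝ, 0 < γ' ∧ ∀ v ∈ Box γ' k, |S.β1 k v| ≤ δ)
    (h : ScaleShiftRate c ρ γ β) :
    ∃ binf : ℝ, ∀ k, |S.β0 k - binf| ≤ c / (1 - ρ) * ρ ^ k := by
  have hstep : ∀ n, dist (S.β0 n) (S.β0 (n + 1)) ≤ c * ρ ^ n := fun n => by
    rw [Real.dist_eq, abs_sub_comm]
    exact abs_beta0_step_le_of_scaleShiftRate_anchor S hγ hA h n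
  obtain ⟨binf, hlim⟩ := cauchySeq_tendsto_of_complete (cauchySeq_of_le_geometric ρ c hρ1 hstep)
  refine ⟨binf, fun k => ?_⟩
  have hk := dist_le_of_le_geometric_of_tendsto ρ c hρ1 hstep hlim k
  rw [Real.dist_eq] at hk
  calc |S.β0 k - binf| ≤ c * ρ ^ k / (1 - ρ) := hk
    _ = c / (1 - ρ) * ρ ^ k := by ring

/-- NE4 (`0 ≤ ρ < 1`) + anchor ⟹ `EverySlope S γ` (the geometric modulus `c·ρ^k` is summable).  (= the K2⁷ v3 skeleton's `everySlope_of_shiftRate_anchor` composed with its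
junction, here ONE tree theorem straight from NE4.) [cite: Balaban1987RG1, (2.12)-(2.14) p.268 and Thm 3 p.264] -/
theorem everySlope_of_scaleShiftRate_anchor (hγ : 0 < γ) (hρ0 : 0 ≤ ρ) (hρ1 : ρ < 1)
    (hA : ∀ (k : ℕ) (δ : ℝ), 0 < δ → ∃ γ' : ℝ, 0 < γ' ∧ ∀ v ∈ Box γ' k, |S.β1 k v| ≤ δ)
    (h : ScaleShiftRate c ρ γ β) : EverySlope S γ :=
  everySlope_of_summable_shiftModulus_anchor S hγ hA h ((summable_geometric_of_lt_one hρ0 hρ1).mul_left c)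

end Geometric

/-! ## §3 Located negative (kernel): the per-scale anchor ALONE does not give every-slope — node N17's slot (or at least a summable modulus) is load-bearing on line 2 -/

section Witness

/-- The witness β-family: `β_{k+1}(p) := min 1 ((k+1)·p_k)` — remainder only, one-loop numbers `0`. [folklore] -/
private theorem witness_vanish (k : ℕ) (p : Fin (k + 1) → ℝ) (hp : p (Fin.last k) = 0) :
    min (1 : ℝ) ((k + 1) * p (Fin.last k)) = 0 := by
  rw [hp, mul_zero]
  exact min_eq_right zero_le_one

/-- **THE ANCHOR HOLDS BUT EVERY-SLOPE FAILS** for the split `β⁰ ≡ 0`, `β¹_{k+1}(p) = min 1 ((k+1)·p_k)`: at scale `k` the remainder is `≤ δ` on `]0, δ∕(k+1)]^{k+1}` (anchor), yet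
on EVERY box `]0,γ]` the remainder reaches `1` at the scales `k + 1 ≥ 1∕γ` — no k-uniform box at tolerance `s = 1∕2`.  So S2 alone books nothing towards the every-slope road; the
shift control (node N17, or a summable modulus) is what makes the radius uniform in the scale. [folklore] -/
theorem anchor_not_sufficient_for_everySlope :
    ∃ (β : HBeta) (S : B12Beta.OneLoopSplit β),
      (∀ (k : ℕ) (δ : ℝ), 0 < δ → ∃ γ' : ℝ, 0 < γ' ∧ ∀ v ∈ Box γ' k, |S.β1 k v| ≤ δ) ∧ ∀ γ : ℝ, 0 < γ → ¬ EverySlope S γ := by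
  let β : HBeta := fun k p => min (1 : ℝ) ((k + 1) * p (Fin.last k))
  let S : B12Beta.OneLoopSplit β :=
    { β0 := fun _ => 0
      β1 := fun k p => min (1 : ℝ) ((k + 1) * p (Fin.last k))
      split := fun k p => by simp [β]
      vanish := witness_vanish }
  refine ⟨β, S, ?_, ?_⟩
  · intro k δ hδ
    have hk : (0 : ℝ) < k + 1 := by positivity
    refine ⟨δ / (k + 1), div_pos hδ hk, fun v hv => ?_⟩
    have hvk := (mem_box.mp hv) (Fin.last k)
    have hnn : 0 ≤ ((k : ℝ) + 1) * v (Fin.last k) := mul_nonneg hk.le hvk.1.le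
    have hle : ((k : ℝ) + 1) * v (Fin.last k) ≤ δ := by
      calc ((k : ℝ) + 1) * v (Fin.last k) ≤ (k + 1) * (δ / (k + 1)) := mul_le_mul_of_nonneg_left hvk.2 hk.le
        _ = δ := by field_simp
    show |min (1 : ℝ) ((k + 1) * v (Fin.last k))| ≤ δ
    rw [abs_of_nonneg (le_min zero_le_one hnn)]
    exact (min_le_right _ _).trans hle
  · intro γ hγ hES
    obtain ⟨γ₁, hγ₁, -, hR⟩ := hES (1 / 2) one_half_pos
    obtain ⟨k, hk⟩ := exists_nat_ge (1 / γ₁)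
    have hp : (fun _ : Fin (k + 1) => γ₁) ∈ B12Beta.HistBox γ₁ k := fun _ => ⟨hγ₁, le_rfl⟩
    have h := hR k (fun _ => γ₁) hp
    have hkγ : (1 : ℝ) ≤ (k + 1) * γ₁ := by
      have h1 : 1 / γ₁ * γ₁ = 1 := by field_simp
      have h2 : 1 / γ₁ * γ₁ ≤ (k + 1) * γ₁ := mul_le_mul_of_nonneg_right (hk.trans (by linarith)) hγ₁.le
      linarith
    have hmin : min (1 : ℝ) ((k + 1) * γ₁) = 1 := min_eq_left hkγ
    have h' : |min (1 : ℝ) ((k + 1) * γ₁)| ≤ 1 / 2 := h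
    rw [hmin, abs_one] at h'
    linarith

end Witness

/-! ## §4 (edition 2) Located witness: the summable lever is STRICTLY more general than the NE4-keyed one -/

section WitnessSummable

/-- partial sums of `Σ 1/(j+1)²` (the witness's scale profile): one step. [folklore] -/
private theorem psum_succ_sub (k : ℕ) :
    (∑ j ∈ range (k + 1), (1 : ℝ) / ((j + 1 : ℕ) : ℝ) ^ 2) - ∑ j ∈ range k, (1 : ℝ) / ((j + 1 : ℕ) : ℝ) ^ 2
      = 1 / ((k + 1 : ℕ) : ℝ) ^ 2 := by
  rw [Finset.sum_range_succ]; ring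

/-- **A SUMMABLE-BUT-NOT-GEOMETRIC SCALE SHIFT WITH THE ANCHOR (kernel witness)** `β_{k+1}(p) := (Σ_{j<k} 1∕(j+1)²)·min 1 p_k`, `β⁰ ≡ 0`: the per-scale anchor holds; on EVERY
window the full β has the SUMMABLE modulus `1∕(k+1)²` (so every-slope HOLDS by `everySlope_of_summable_shiftModulus_anchor`), yet `ScaleShiftRate c ρ γ β` FAILS for every `c`,
every `0 ≤ ρ < 1` (at the constant history the shift IS `min 1 γ ∕ (k+1)²`, while `(k+1)²ρ^k → 0`).  The summable lever is STRICTLY more general than the NE4-keyed one. [folklore] -/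
theorem summable_shiftModulus_anchor_not_geometric :
    ∃ (β : HBeta) (S : B12Beta.OneLoopSplit β),
      (∀ (k : ℕ) (δ : ℝ), 0 < δ → ∃ γ' : ℝ, 0 < γ' ∧ ∀ v ∈ Box γ' k, |S.β1 k v| ≤ δ) ∧
      (∀ γ : ℝ, 0 < γ →
        (∀ k (w : Fin (k + 2) → ℝ), w ∈ Box γ (k + 1) → |β (k + 1) w - β k (Fin.tail w)| ≤ 1 / ((k + 1 : ℕ) : ℝ) ^ 2) ∧
        EverySlope S γ ∧ ∀ c ρ : ℝ, 0 ≤ ρ → ρ < 1 → ¬ ScaleShiftRate c ρ γ β) ∧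
      Summable (fun k : ℕ => 1 / ((k + 1 : ℕ) : ℝ) ^ 2) := by
  let s : ℕ → ℝ := fun k => ∑ j ∈ range k, (1 : ℝ) / ((j + 1 : ℕ) : ℝ) ^ 2
  let β : HBeta := fun k p => s k * min 1 (p (Fin.last k))
  let S : B12Beta.OneLoopSplit β :=
    { β0 := fun _ => 0
      β1 := fun k p => s k * min 1 (p (Fin.last k))
      split := fun k p => by simp [β]
      vanish := fun k p hp => by simp [hp] }
  have hsum : Summable (fun k : ℕ => 1 / ((k + 1 : ℕ) : ℝ) ^ 2) :=
    (summable_nat_add_iff 1).mpr (Real.summable_one_div_nat_pow.mpr one_lt_two)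
  have hA : ∀ (k : ℕ) (δ : ℝ), 0 < δ → ∃ γ' : ℝ, 0 < γ' ∧ ∀ v ∈ Box γ' k, |S.β1 k v| ≤ δ := by
    intro k δ hδ
    have hs : 0 ≤ s k := Finset.sum_nonneg fun j _ => by positivity
    refine ⟨δ / (s k + 1), div_pos hδ (by linarith), fun v hv => ?_⟩
    have hvk := (mem_box.mp hv) (Fin.last k)
    show |s k * min 1 (v (Fin.last k))| ≤ δ
    rw [abs_of_nonneg (mul_nonneg hs (le_min zero_le_one hvk.1.le))]
    calc s k * min 1 (v (Fin.last k)) ≤ s k * (δ / (s k + 1)) := mul_le_mul_of_nonneg_left ((min_le_right _ _).trans hvk.2) hs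
      _ ≤ (s k + 1) * (δ / (s k + 1)) := mul_le_mul_of_nonneg_right (by linarith) (div_pos hδ (by linarith)).le
      _ = δ := by field_simp
  have hshift : ∀ k (w : Fin (k + 2) → ℝ), β (k + 1) w - β k (Fin.tail w) = 1 / ((k + 1 : ℕ) : ℝ) ^ 2 * min 1 (w (Fin.last (k + 1))) := by
    intro k w
    have htail : Fin.tail w (Fin.last k) = w (Fin.last (k + 1)) := by simp only [Fin.tail, Fin.succ_last]
    show s (k + 1) * min 1 (w (Fin.last (k + 1))) - s k * min 1 (Fin.tail w (Fin.last k)) = _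
    rw [htail, ← sub_mul, psum_succ_sub]
  have hmod : ∀ γ : ℝ, 0 < γ → ∀ k (w : Fin (k + 2) → ℝ), w ∈ Box γ (k + 1) → |β (k + 1) w - β k (Fin.tail w)| ≤ 1 / ((k + 1 : ℕ) : ℝ) ^ 2 := by
    intro γ hγ k w hw
    have hwk := (mem_box.mp hw) (Fin.last (k + 1))
    have hpos : 0 ≤ 1 / ((k + 1 : ℕ) : ℝ) ^ 2 := by positivity
    rw [hshift, abs_of_nonneg (mul_nonneg hpos (le_min zero_le_one hwk.1.le))]
    simpa using mul_le_mul_of_nonneg_left (min_le_left (1 : ℝ) (w (Fin.last (k + 1)))) hpos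
  refine ⟨β, S, hA, fun γ hγ => ⟨hmod γ hγ, everySlope_of_summable_shiftModulus_anchor S hγ hA (hmod γ hγ) hsum, ?_⟩, hsum⟩
  intro c ρ hρ0 hρ1 hgeo
  set m : ℝ := min 1 γ with hm
  have hm0 : 0 < m := lt_min one_pos hγ
  -- at the constant history `(γ,…,γ)` the shift is `m / (k+1)²`, whence `m ≤ c·(k+1)²·ρ^k`
  have hle : ∀ k : ℕ, m ≤ c * (((k + 1 : ℕ) : ℝ) ^ 2 * ρ ^ k) := by
    intro k
    have h := hgeo k (fun _ => γ) (mem_box.mpr fun _ => ⟨hγ, le_rfl⟩)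
    have e : β (k + 1) (fun _ => γ) - β k (Fin.tail fun _ => γ) = 1 / ((k + 1 : ℕ) : ℝ) ^ 2 * m := hshift k (fun _ => γ)
    have hk : (0 : ℝ) < ((k + 1 : ℕ) : ℝ) ^ 2 := by positivity
    have h' : |1 / ((k + 1 : ℕ) : ℝ) ^ 2 * m| ≤ c * ρ ^ k := by simpa only [e] using h
    rw [abs_of_nonneg (mul_nonneg (by positivity) hm0.le), one_div_mul_eq_div, div_le_iff₀ hk] at h'
    linarith
  rcases eq_or_lt_of_le hρ0 with hρz | hρpos
  · have h1 := hle 1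
    rw [← hρz] at h1
    norm_num at h1
    linarith
  · have hlim : Tendsto (fun k : ℕ => c * ρ⁻¹ * (((k + 1 : ℕ) : ℝ) ^ 2 * ρ ^ (k + 1))) atTop (𝓝 (c * ρ⁻¹ * 0)) :=
      ((tendsto_pow_const_mul_const_pow_of_abs_lt_one 2 (by rwa [abs_of_nonneg hρ0])).comp (tendsto_add_atTop_nat 1)).const_mul _
    rw [mul_zero] at hlim
    obtain ⟨k, hk⟩ := (hlim.eventually (gt_mem_nhds hm0)).exists
    have e : c * ρ⁻¹ * (((k + 1 : ℕ) : ℝ) ^ 2 * ρ ^ (k + 1)) = c * (((k + 1 : ℕ) : ℝ) ^ 2 * ρ ^ k) := by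
      rw [pow_succ ρ k]; field_simp
    linarith [hle k, e ▸ hk]

end WitnessSummable

end Summit.QuantumFields.YangMills.BalabanUVNodes.N17ShiftModulusAnchor

end
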